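import Summits.Ventures.HSemireg.WedgeHankelRecurrenceGaussUvarov

/-!
# Venture HSemireg — **STIELTJES–ROUTH–HURWITZ VIA THE RECURRENCE**: for a positive recurrence `q_0 = 1`, `q_1 = X − a_0`, `q_{k+2} = (X − a_{k+1}) q_{k+1} − b_{k+1} q_k` with `q_k(0) > 0` for all
# `k ≤ m + 2` (equivalently, by Szegő's Sturm count N294 at `ξ = 0`, all zeros of `q_{m+2}` are negative), and every `c > 0`, the real polynomial `q_{m+2}(z²) + c z q_{m+1}(z²)` is HURWITZ STABLE:
# all its complex zeros have negative real part — the interlacing of N279 fed into the tree's Hermite–Biehler ∕ interlacing criterion `forall_re_neg_iff_interlacing`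

HONEST FRAMING. Part of the Lean index of the computation cell `pub-hsemireg` (seat p10 gen 43, Sunday typer «UNIFORM-IN-n»).  Real and complex polynomials and their zeros only; no variety, no
cohomology theory, no sheaf, no Ext group and no semiregularity map is constructed here; nothing here says that HC / HC_CM / HC_AV holds; no Literature fact (unproved `Prop`) is declared or used.
Custodian versions as in `WedgeHankelSiegelIdeal` (1/3).
SOURCES (cited).  T. J. Stieltjes, *Recherches sur les fractions continues*, Ann. Fac. Sci. Toulouse 8 (1894); F. R. Gantmacher, *The Theory of Matrices* II, Ch. XV §§ 13–14, Thm 13 and §16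
(Stieltjes' theorem: Hurwitz stability ⟺ the even–odd parts form a positive pair ⟺ a Stieltjes continued fraction with positive coefficients); C. Hermite (1856), M. Biehler (1879) (the
Hermite–Biehler theorem); G. Szegő, *Orthogonal Polynomials*, Thm 3.3.4; T. S. Chihara, *An Introduction to Orthogonal Polynomials* (1978), Ch. I Thm 5.3 and §9 (chain sequences).
PROOF TYPED HERE.  `q_k(0) > 0` for `k ≤ n` kills every sign change at `ξ = 0`, so N294 `sturm_count_recurrence` gives no zero of `q_n` above `0` (and `0` is not a zero): all zeros are negative;
N279 `recurrence_zeros_interlace` gives the strict interlacing of the zeros of `q_{m+1}` and `q_{m+2}`; the tree's `forall_re_neg_iff_interlacing` (Hermite–Biehler ∕ positive pairs, N24x) turns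
«interlacing + all zeros negative + positive leading coefficients» into Hurwitz stability of `h(z²) + z g(z²)` with `h = q_{m+2}`, `g = c q_{m+1}`.
DEDUP DISCLOSURE (`rg -n 'recurrence_hurwitz|hurwitz_of_recurrence|zeros_neg_of_forall_eval' Summits/Ventures/HSemireg`, 2026-09-03): the tree's Hurwitz files (`Interlacing`, `MarkovHurwitz`,
`HermiteBiehler`, …) state the criteria for given `h, g`; feeding the orthogonal-polynomial recurrence into them is new.  The 3 names below: 0 hits tree-wide.

WHAT IS IN THE TREE.  `forall_re_neg_iff_interlacing` (Interlacing); N279 `recurrence_zeros_interlace`, `recurrence_monic_natDegree`; N294 `sturm_count_recurrence`, `strictMono_eq_of_prod_X_sub_C_eq`; N298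
`roots_prod_X_sub_C_fin`; Mathlib `Polynomial.roots_C_mul`, `leadingCoeff_mul`, `natDegree_C_mul`, `Polynomial.expand`.
THIS FILE (namespace `Summit.Ventures.HSemireg.Wedge.HankelOuter` continued; CHAINED on N305 (import), N279, N294, N298; 0 definitions):
* §1071 **`recurrence_zeros_neg_of_forall_eval_zero_pos`** (`q_k(0) > 0` for `k ≤ n` ⇒ all zeros of `q_n` are `< 0`), **`recurrence_hurwitz_stable_of_zeros_neg`** (zeros of `q_{m+2}` negative, `c > 0` ⇒
  `q_{m+2}(z²) + c z q_{m+1}(z²)` is Hurwitz stable), **`recurrence_hurwitz_stable`** (STIELTJES: `q_k(0) > 0` for `k ≤ m + 2` and `c > 0` ⇒ Hurwitz stable).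
CAVEATS.  The even–odd composition is Mathlib's `expand ℝ 2 h + X * expand ℝ 2 g`, as in the tree's Hurwitz files.  Nothing Ext-side.  New names only.
-/

open Module Polynomial
open scoped Matrix Polynomial

namespace Summit.Ventures.HSemireg.Wedge.HankelOuter

/-! ## §1071. Hurwitz stability from a positive recurrence -/

/-- **`q_k(0) > 0` for all `k ≤ n` forces all zeros of `q_n` to be negative** (Szegő's Sturm count at `ξ = 0`: no sign change, hence no zero above `0`; and `0` itself is not a zero).
[Szegő Thm 3.3.4; Gantmacher XV §14; this file, §1071] -/
theorem recurrence_zeros_neg_of_forall_eval_zero_pos {q : ℕ → ℝ[X]} {a b : ℕ → ℝ} (hq0 : q 0 = 1) (hq1 : q 1 = Polynomial.X - C (a 0))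
    (hrec : ∀ n, q (n + 2) = (Polynomial.X - C (a (n + 1))) * q (n + 1) - C (b (n + 1)) * q n) (hb : ∀ j, 0 < b j) {n : ℕ} {z : Fin n → ℝ}
    (hz : StrictMono z) (hzq : q n = ∏ i, (Polynomial.X - C (z i))) (hpos : ∀ k, k ≤ n → 0 < (q k).eval 0) (i : Fin n) : z i < 0 := by
  have hcount := sturm_count_recurrence hq0 hq1 hrec hb n hz hzq (ξ := 0) (fun k hk => (hpos k hk).ne')
  have hempty : ((Finset.range n).filter (fun k => (q k).eval 0 * (q (k + 1)).eval 0 < 0)).card = 0 := by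
    rw [Finset.card_eq_zero, Finset.filter_eq_empty_iff]
    intro k hk
    have hk' := Finset.mem_range.1 hk
    exact not_lt.2 (mul_pos (hpos k hk'.le) (hpos (k + 1) hk')).le
  rw [hempty, eq_comm, Finset.card_eq_zero, Finset.filter_eq_empty_iff] at hcount
  have hle : z i ≤ 0 := not_lt.1 (hcount (Finset.mem_univ i))
  refine lt_of_le_of_ne hle fun h0 => ?_
  have hroot : (q n).eval (z i) = 0 := by
    rw [hzq, eval_prod]; exact Finset.prod_eq_zero (Finset.mem_univ i) (by simp)
  rw [h0] at hroot
  exact (hpos n le_rfl).ne' hroot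

/-- **Hurwitz stability from interlacing negative zeros**: if `q_{m+2} = ∏_k (X − y_k)` with `y_0 < ⋯ < y_{m+1} < 0` (positive recurrence) and `c > 0`, then every complex zero of
`q_{m+2}(z²) + c z q_{m+1}(z²)` has negative real part. [Gantmacher XV §14 Thm 13; Hermite–Biehler; this file, §1071] -/
theorem recurrence_hurwitz_stable_of_zeros_neg {q : ℕ → ℝ[X]} {a b : ℕ → ℝ} (hq0 : q 0 = 1) (hq1 : q 1 = Polynomial.X - C (a 0))
    (hrec : ∀ n, q (n + 2) = (Polynomial.X - C (a (n + 1))) * q (n + 1) - C (b (n + 1)) * q n) (hb : ∀ j, 0 < b j) {m : ℕ} {y : Fin (m + 2) → ℝ}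
    (hy : StrictMono y) (hyq : q (m + 2) = ∏ k, (Polynomial.X - C (y k))) (hneg : ∀ k, y k < 0) {c : ℝ} (hc : 0 < c) :
    ∀ ζ ∈ ((expand ℝ 2 (q (m + 2)) + Polynomial.X * expand ℝ 2 (C c * q (m + 1))).map (algebraMap ℝ ℂ)).roots, ζ.re < 0 := by
  have hmd := recurrence_monic_natDegree hq0 hq1 hrec
  obtain ⟨z, y', hz, hy', hzq, hy'q, hint⟩ := recurrence_zeros_interlace hq0 hq1 hrec hb m
  have hyy : y' = y := strictMono_eq_of_prod_X_sub_C_eq hy' hy (hy'q.symm.trans hyq)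
  subst hyy
  have hh : (q (m + 2)).natDegree = m + 1 + 1 := (hmd (m + 2)).2
  have hg : (C c * q (m + 1)).natDegree ≤ m + 1 := by rw [natDegree_C_mul hc.ne', (hmd (m + 1)).2]
  have hlc : 0 < (q (m + 2)).leadingCoeff := by rw [(hmd (m + 2)).1.leadingCoeff]; exact one_pos
  refine (forall_re_neg_iff_interlacing (m + 1) hh hg hlc).2 ⟨y', z, hy', hz, ?_, ?_, ?_, ?_, hint, hneg _⟩
  · rw [hy'q, roots_prod_X_sub_C_fin]
  · rw [roots_C_mul _ hc.ne', hzq, roots_prod_X_sub_C_fin]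
  · rw [natDegree_C_mul hc.ne', (hmd (m + 1)).2]
  · rw [leadingCoeff_mul, leadingCoeff_C, (hmd (m + 1)).1.leadingCoeff, mul_one]; exact hc

/-- **STIELTJES–ROUTH–HURWITZ VIA THE RECURRENCE.**  For a positive recurrence (`b_j > 0`) with `q_k(0) > 0` for all `k ≤ m + 2` and any `c > 0`, the polynomial `q_{m+2}(z²) + c z q_{m+1}(z²)` is
Hurwitz stable: every complex zero has negative real part. [Stieltjes 1894; Gantmacher XV §14 Thm 13 + §16; Hermite–Biehler; this file, §1071] -/
theorem recurrence_hurwitz_stable {q : ℕ → ℝ[X]} {a b : ℕ → ℝ} (hq0 : q 0 = 1) (hq1 : q 1 = Polynomial.X - C (a 0))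
    (hrec : ∀ n, q (n + 2) = (Polynomial.X - C (a (n + 1))) * q (n + 1) - C (b (n + 1)) * q n) (hb : ∀ j, 0 < b j) {m : ℕ}
    (hpos : ∀ k, k ≤ m + 2 → 0 < (q k).eval 0) {c : ℝ} (hc : 0 < c) :
    ∀ ζ ∈ ((expand ℝ 2 (q (m + 2)) + Polynomial.X * expand ℝ 2 (C c * q (m + 1))).map (algebraMap ℝ ℂ)).roots, ζ.re < 0 := by
  obtain ⟨z, y, -, hy, -, hyq, -⟩ := recurrence_zeros_interlace hq0 hq1 hrec hb m
  exact recurrence_hurwitz_stable_of_zeros_neg hq0 hq1 hrec hb hy hyq (recurrence_zeros_neg_of_forall_eval_zero_pos hq0 hq1 hrec hb hy hyq hpos) hc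

end Summit.Ventures.HSemireg.Wedge.HankelOuter
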